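import Mathlib
import Summits.KontsevichZagierPeriods.KontsevichZagierPeriods.Theorems.SoloInformedPellAbelBand
import HarnessLib
import HarnessLib.Audit

/-!
# The circular order-three torsion packet: the kernel identities

The second component of the order-three torsion locus of `Π(n | m)`: along the real algebraic
curve `1/3 < r² < 1`, `0 < r`,

  `m(r) = (1−r²)³(3r²+1)/(16r⁶)`,  `n(r) = (1−r²)(3r²+1)/(4r²)`  (`m < n < 1`, the circular case),

the unit `A + B√Δ`, `Δ = (1−t²)(1−mt²) ≤ 0` beyond `t = 1`, with

  `A = (1 − mt²)(1 + at²)`, `B = bt`, `a = −(3r²+1)/2`, `b = (9r⁴−1)/(4r³)`,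

has norm `A² + B²(−Δ)·(−1) = A² + B²Δ' ` — precisely `A² + B²(1−t²)(1−mt²) = (1−mt²)(1−nt²)³` —
and logarithmic derivative `(q₀ + q₂t²)(1−mt²)(1−nt²)²`, `q₀ = (9r⁴−1)/(2r³)`,
`q₂ = (1−r²)(9r⁴−1)/(4r⁵)`; `A(0) = 1`, `A(1) < 0`, `B > 0` on `(0,1)`.  The circular Abel
theorem (`SoloInformedPellAbelCircLaw`) then gives `Π(n|m) = αK + 2βπ` with
`α = 2/(3(1+r²))`, `β = 2r³/(3(1+r²)(3r²−1))`.  This file: the identities (`field_simp; ring`),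
the signs, the algebraicity and the semialgebraicity of the data.
-/

noncomputable section

open MeasureTheory Set Filter
open scoped Classical

open Literature.NumberTheory.Transcendental Literature.NumberTheory.Transcendental.KZ
open Literature.ModelTheory.ExponentialFields

namespace Summit.KontsevichZagierPeriods.KontsevichZagierPeriods.Theorems

/-! ### The circular order-three data -/

/-- The modulus `m(r) = (1−r²)³(3r²+1)/(16r⁶)`. [this work] -/
def soloInformedC3m (r : ℝ) : ℝ := (1 - r ^ 2) ^ 3 * (3 * r ^ 2 + 1) / (16 * r ^ 6)

/-- The parameter `n(r) = (1−r²)(3r²+1)/(4r²)`. [this work] -/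
def soloInformedC3n (r : ℝ) : ℝ := (1 - r ^ 2) * (3 * r ^ 2 + 1) / (4 * r ^ 2)

/-- `a(r) = −(3r²+1)/2`. [this work] -/
def soloInformedC3a (r : ℝ) : ℝ := -(3 * r ^ 2 + 1) / 2

/-- `b(r) = (9r⁴−1)/(4r³)`. [this work] -/
def soloInformedC3b (r : ℝ) : ℝ := (9 * r ^ 4 - 1) / (4 * r ^ 3)

/-- `A(r,t) = (1 − mt²)(1 + at²)`. [this work] -/
def soloInformedC3A (r t : ℝ) : ℝ := (1 - soloInformedC3m r * t ^ 2) * (1 + soloInformedC3a r * t ^ 2)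

/-- `B(r,t) = bt`. [this work] -/
def soloInformedC3B (r t : ℝ) : ℝ := soloInformedC3b r * t

/-- `q₀(r) = 2b`. [this work] -/
def soloInformedC3q0 (r : ℝ) : ℝ := (9 * r ^ 4 - 1) / (2 * r ^ 3)

/-- `q₂(r) = (1−r²)(9r⁴−1)/(4r⁵)`. [this work] -/
def soloInformedC3q2 (r : ℝ) : ℝ := (1 - r ^ 2) * (9 * r ^ 4 - 1) / (4 * r ^ 5)

/-- `α(r) = 2/(3(1+r²))`. [this work] -/
def soloInformedC3alpha (r : ℝ) : ℝ := 2 / (3 * (1 + r ^ 2))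

/-- `β(r) = 2r³/(3(1+r²)(3r²−1))`. [this work] -/
def soloInformedC3beta (r : ℝ) : ℝ := 2 * r ^ 3 / (3 * (1 + r ^ 2) * (3 * r ^ 2 - 1))

/-! ### The polynomial identities -/

/-- **Norm identity** `A² + B²Δ = (1−mt²)(1−nt²)²·(1−nt²)`. [this work] -/
theorem soloInformed_c3_norm {r : ℝ} (hr : r ≠ 0) (t : ℝ) :
    soloInformedC3A r t ^ 2 + soloInformedC3B r t ^ 2 * ((1 - t ^ 2) * (1 - soloInformedC3m r * t ^ 2)) =
      (1 - soloInformedC3m r * t ^ 2) * (1 - soloInformedC3n r * t ^ 2) ^ 2 *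
        (1 - soloInformedC3n r * t ^ 2) := by
  unfold soloInformedC3A soloInformedC3B soloInformedC3m soloInformedC3n soloInformedC3a soloInformedC3b
  field_simp
  ring

/-- **The logarithmic derivative of the unit**: `2(AB′ − A′B)Δ + ABΔ′ = (q₀+q₂t²)(1−mt²)(1−nt²)²`,
with `A′, B′, Δ′` written as the product rule delivers them. [this work] -/
theorem soloInformed_c3_numerator {r : ℝ} (hr : r ≠ 0) (t : ℝ) :
    2 * (soloInformedC3A r t * (soloInformedC3b r * 1) -
        (-(soloInformedC3m r * (2 * t)) * (1 + soloInformedC3a r * t ^ 2) +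
          (1 - soloInformedC3m r * t ^ 2) * (soloInformedC3a r * (2 * t))) * soloInformedC3B r t) *
        ((1 - t ^ 2) * (1 - soloInformedC3m r * t ^ 2)) +
      soloInformedC3A r t * soloInformedC3B r t *
        (-(2 * t) * (1 - soloInformedC3m r * t ^ 2) + (1 - t ^ 2) * (-(soloInformedC3m r * (2 * t)))) =
      (soloInformedC3q0 r + soloInformedC3q2 r * t ^ 2) *
        ((1 - soloInformedC3m r * t ^ 2) * (1 - soloInformedC3n r * t ^ 2) ^ 2) := by
  unfold soloInformedC3A soloInformedC3B soloInformedC3m soloInformedC3n soloInformedC3a soloInformedC3b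
    soloInformedC3q0 soloInformedC3q2
  field_simp
  ring

/-- `q₂ + nq₀ = 3(1−r²)(r²+1)(3r²−1)(3r²+1)/(8r⁵)`. [this work] -/
theorem soloInformed_c3_res_eq {r : ℝ} (hr : r ≠ 0) :
    soloInformedC3q2 r + soloInformedC3n r * soloInformedC3q0 r =
      3 * (1 - r ^ 2) * (r ^ 2 + 1) * (3 * r ^ 2 - 1) * (3 * r ^ 2 + 1) / (8 * r ^ 5) := by
  unfold soloInformedC3q2 soloInformedC3n soloInformedC3q0
  field_simp
  ring

/-- `1 − m(r) = (r²+1)³(3r²−1)/(16r⁶)`. [this work] -/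
theorem soloInformed_c3_one_sub_m {r : ℝ} (hr : r ≠ 0) :
    1 - soloInformedC3m r = (r ^ 2 + 1) ^ 3 * (3 * r ^ 2 - 1) / (16 * r ^ 6) := by
  unfold soloInformedC3m
  field_simp
  ring

/-- `1 − n(r) = (r²+1)(3r²−1)/(4r²)`. [this work] -/
theorem soloInformed_c3_one_sub_n {r : ℝ} (hr : r ≠ 0) :
    1 - soloInformedC3n r = (r ^ 2 + 1) * (3 * r ^ 2 - 1) / (4 * r ^ 2) := by
  unfold soloInformedC3n
  field_simp
  ring

/-- `A(r,1) = −(1−m)(3r²−1)/2`. [this work] -/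
theorem soloInformed_c3_A_one_eq (r : ℝ) :
    soloInformedC3A r 1 = -((1 - soloInformedC3m r) * ((3 * r ^ 2 - 1) / 2)) := by
  unfold soloInformedC3A soloInformedC3a
  ring

/-! ### Positivity on the parameter range `1/3 < r² < 1`, `0 < r` -/

/-- `m(r) ∈ (0,1)`. [this work] -/
theorem soloInformed_c3_m_mem {r : ℝ} (hr : 1 < 3 * r ^ 2) (hr' : r ^ 2 < 1) :
    soloInformedC3m r ∈ Ioo (0:ℝ) 1 := by
  have hr0 : r ≠ 0 := by rintro rfl; norm_num at hr
  refine ⟨?_, ?_⟩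
  · unfold soloInformedC3m
    exact div_pos (mul_pos (pow_pos (by linarith) 3) (by positivity)) (by positivity)
  · have h := soloInformed_c3_one_sub_m hr0
    have : 0 < (r ^ 2 + 1) ^ 3 * (3 * r ^ 2 - 1) / (16 * r ^ 6) :=
      div_pos (mul_pos (by positivity) (by linarith)) (by positivity)
    linarith

/-- `n(r) ∈ (0,1)`. [this work] -/
theorem soloInformed_c3_n_mem {r : ℝ} (hr : 1 < 3 * r ^ 2) (hr' : r ^ 2 < 1) :
    soloInformedC3n r ∈ Ioo (0:ℝ) 1 := by
  have hr0 : r ≠ 0 := by rintro rfl; norm_num at hr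
  refine ⟨?_, ?_⟩
  · unfold soloInformedC3n
    exact div_pos (mul_pos (by linarith) (by positivity)) (by positivity)
  · have h := soloInformed_c3_one_sub_n hr0
    have : 0 < (r ^ 2 + 1) * (3 * r ^ 2 - 1) / (4 * r ^ 2) :=
      div_pos (mul_pos (by positivity) (by linarith)) (by positivity)
    linarith

/-- `0 < b(r)` for `0 < r`, `1 < 3r²`. [this work] -/
theorem soloInformed_c3_b_pos {r : ℝ} (hr : 1 < 3 * r ^ 2) (h0 : 0 < r) : 0 < soloInformedC3b r := by
  have h9 : 0 < 9 * r ^ 4 - 1 := by nlinarith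
  unfold soloInformedC3b
  positivity

/-- `A(r,0) = 1`, `A(r,1) < 0`. [this work] -/
theorem soloInformed_c3_A_ends {r : ℝ} (hr : 1 < 3 * r ^ 2) (hr' : r ^ 2 < 1) :
    0 < soloInformedC3A r 0 ∧ soloInformedC3A r 1 < 0 := by
  have hm := soloInformed_c3_m_mem hr hr'
  refine ⟨by norm_num [soloInformedC3A], ?_⟩
  rw [soloInformed_c3_A_one_eq]
  have : 0 < (1 - soloInformedC3m r) * ((3 * r ^ 2 - 1) / 2) := mul_pos (by linarith [hm.2]) (by linarith)
  linarith

/-- `0 < R(r,t) = (1−mt²)(1−nt²)²` for `t² ≤ 1`. [this work] -/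
theorem soloInformed_c3_R_pos {r t : ℝ} (hr : 1 < 3 * r ^ 2) (hr' : r ^ 2 < 1) (ht : t ^ 2 ≤ 1) :
    0 < (1 - soloInformedC3m r * t ^ 2) * (1 - soloInformedC3n r * t ^ 2) ^ 2 := by
  have hm := soloInformed_c3_m_mem hr hr'
  have hn := soloInformed_c3_n_mem hr hr'
  have h1 := mul_le_of_le_one_right hm.1.le ht
  have h2 := mul_le_of_le_one_right hn.1.le ht
  exact mul_pos (by linarith [hm.2]) (pow_pos (by linarith [hn.2]) 2)

/-- `0 < q₂ + nq₀` (the residue condition). [this work] -/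
theorem soloInformed_c3_res_pos {r : ℝ} (hr : 1 < 3 * r ^ 2) (hr' : r ^ 2 < 1) (h0 : 0 < r) :
    0 < soloInformedC3q2 r + soloInformedC3n r * soloInformedC3q0 r := by
  rw [soloInformed_c3_res_eq h0.ne']
  exact div_pos (mul_pos (mul_pos (mul_pos (mul_pos (by norm_num) (by linarith)) (by positivity))
    (by linarith)) (by positivity)) (by positivity)

/-- `q₂/(q₂ + nq₀) = α(r)` and `n/(q₂ + nq₀) = β(r)`. [this work] -/
theorem soloInformed_c3_alpha_beta_eq {r : ℝ} (hr : 1 < 3 * r ^ 2) (hr' : r ^ 2 < 1) (h0 : 0 < r) :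
    soloInformedC3q2 r / (soloInformedC3q2 r + soloInformedC3n r * soloInformedC3q0 r) =
      soloInformedC3alpha r ∧
    soloInformedC3n r / (soloInformedC3q2 r + soloInformedC3n r * soloInformedC3q0 r) =
      soloInformedC3beta r := by
  have hr0 : r ≠ 0 := h0.ne'
  have hres := (soloInformed_c3_res_pos hr hr' h0).ne'
  have h1 : 1 + r ^ 2 ≠ 0 := by positivity
  have h3 : 3 * r ^ 2 - 1 ≠ 0 := by linarith
  have h4 : 4 * r ^ 2 ≠ 0 := by positivity
  have hd : 3 * (1 + r ^ 2) * (3 * r ^ 2 - 1) * (8 * r ^ 5) ≠ 0 :=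
    mul_ne_zero (mul_ne_zero (mul_ne_zero (by norm_num) h1) h3) (by positivity)
  refine ⟨?_, ?_⟩
  · rw [div_eq_iff hres, soloInformed_c3_res_eq hr0]
    unfold soloInformedC3q2 soloInformedC3alpha
    field_simp
    ring
  · rw [div_eq_iff hres, soloInformed_c3_res_eq hr0]
    unfold soloInformedC3n soloInformedC3beta
    rw [div_mul_div_comm, div_eq_div_iff h4 hd]
    ring

/-! ### Algebraicity and semialgebraicity -/

/-- `m, n, a, b, q₀, q₂, α, β ∈ ℚ(r)` are algebraic for algebraic `r`. [folklore] -/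
theorem soloInformed_c3_isAlgebraic {r : ℝ} (hra : IsAlgebraic ℚ r) :
    IsAlgebraic ℚ (soloInformedC3m r) ∧ IsAlgebraic ℚ (soloInformedC3n r) ∧
      IsAlgebraic ℚ (soloInformedC3a r) ∧ IsAlgebraic ℚ (soloInformedC3b r) ∧
      IsAlgebraic ℚ (soloInformedC3q0 r) ∧ IsAlgebraic ℚ (soloInformedC3q2 r) ∧
      IsAlgebraic ℚ (soloInformedC3alpha r) ∧ IsAlgebraic ℚ (soloInformedC3beta r) := by
  have hs : r ∈ algebraicClosure ℚ ℝ := mem_algebraicClosure_iff.2 hra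
  have hN : ∀ k : ℕ, (k : ℝ) ∈ algebraicClosure ℚ ℝ := fun k => natCast_mem _ k
  have h2 : (2:ℝ) ∈ algebraicClosure ℚ ℝ := by exact_mod_cast hN 2
  have h3 : (3:ℝ) ∈ algebraicClosure ℚ ℝ := by exact_mod_cast hN 3
  have h4 : (4:ℝ) ∈ algebraicClosure ℚ ℝ := by exact_mod_cast hN 4
  have h9 : (9:ℝ) ∈ algebraicClosure ℚ ℝ := by exact_mod_cast hN 9
  have h16 : (16:ℝ) ∈ algebraicClosure ℚ ℝ := by exact_mod_cast hN 16
  refine ⟨mem_algebraicClosure_iff.1 ?_, mem_algebraicClosure_iff.1 ?_, mem_algebraicClosure_iff.1 ?_,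
    mem_algebraicClosure_iff.1 ?_, mem_algebraicClosure_iff.1 ?_, mem_algebraicClosure_iff.1 ?_,
    mem_algebraicClosure_iff.1 ?_, mem_algebraicClosure_iff.1 ?_⟩
  · unfold soloInformedC3m; apply_rules (transparency := .reducible) (maxDepth := 250) only
      [pow_mem, div_mem, mul_mem, sub_mem, add_mem, one_mem, hs, h2, h3, h4, h16]
  · unfold soloInformedC3n; apply_rules (transparency := .reducible) (maxDepth := 250) only
      [pow_mem, div_mem, mul_mem, sub_mem, add_mem, one_mem, hs, h2, h3, h4, h16]
  · unfold soloInformedC3a; apply_rules (transparency := .reducible) (maxDepth := 250) only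
      [pow_mem, div_mem, mul_mem, sub_mem, add_mem, one_mem, neg_mem, hs, h2, h3, h4, h16]
  · unfold soloInformedC3b; apply_rules (transparency := .reducible) (maxDepth := 250) only
      [pow_mem, div_mem, mul_mem, sub_mem, add_mem, one_mem, hs, h2, h3, h4, h9, h16]
  · unfold soloInformedC3q0; apply_rules (transparency := .reducible) (maxDepth := 250) only
      [pow_mem, div_mem, mul_mem, sub_mem, add_mem, one_mem, hs, h2, h3, h4, h9, h16]
  · unfold soloInformedC3q2; apply_rules (transparency := .reducible) (maxDepth := 250) only
      [pow_mem, div_mem, mul_mem, sub_mem, add_mem, one_mem, hs, h2, h3, h4, h9, h16]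
  · unfold soloInformedC3alpha; apply_rules (transparency := .reducible) (maxDepth := 250) only
      [pow_mem, div_mem, mul_mem, sub_mem, add_mem, one_mem, hs, h2, h3, h4, h16]
  · unfold soloInformedC3beta; apply_rules (transparency := .reducible) (maxDepth := 250) only
      [pow_mem, div_mem, mul_mem, sub_mem, add_mem, one_mem, hs, h2, h3, h4, h16]

/-- `A(r, wᵢ)`, `A′(r, wᵢ)`, `B(r, wᵢ)`, `B′` are `ℚ`-semialgebraic (algebraic `r`). [this work] -/
theorem soloInformed_c3_sa {S : Set (Fin 2 → ℝ)} (hS : IsSemialgebraic ℚ S) {r : ℝ}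
    (hra : IsAlgebraic ℚ r) (i : Fin 2) :
    IsSemialgebraicFunOn ℚ S (fun w => soloInformedC3A r (w i)) ∧
    IsSemialgebraicFunOn ℚ S (fun w => -(soloInformedC3m r * (2 * w i)) *
        (1 + soloInformedC3a r * w i ^ 2) +
      (1 - soloInformedC3m r * w i ^ 2) * (soloInformedC3a r * (2 * w i))) ∧
    IsSemialgebraicFunOn ℚ S (fun w => soloInformedC3B r (w i)) ∧
    IsSemialgebraicFunOn ℚ S (fun _ => soloInformedC3b r * 1) := by
  obtain ⟨hm, -, ha, hb, -, -, -, -⟩ := soloInformed_c3_isAlgebraic hra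
  have ht : IsSemialgebraicFunOn ℚ S (fun w => w i) :=
    Literature.NumberTheory.Transcendental.isSemialgebraicFunOn_apply hS i
  have h2 : IsAlgebraic ℚ (2:ℝ) := by exact_mod_cast isAlgebraic_nat (R := ℚ) (A := ℝ) 2
  have h4 : IsAlgebraic ℚ (4:ℝ) := by exact_mod_cast isAlgebraic_nat (R := ℚ) (A := ℝ) 4
  have hA1 := SoloInformedPellAbel.sa_quad hS isAlgebraic_one hm.neg i
  have hA2 := SoloInformedPellAbel.sa_quad hS isAlgebraic_one ha i
  have hAd := SoloInformedPellAbel.sa_quad hS (h2.mul (ha.sub hm)) (h4.mul (hm.mul ha)).neg i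
  have hbc : IsSemialgebraicFunOn ℚ S (fun _ => soloInformedC3b r) :=
    isSemialgebraicFunOn_const_of_isAlgebraic hS hb
  refine ⟨(IsSemialgebraicFunOn.mul_holds hA1 hA2).congr fun w _ => ?_,
    (IsSemialgebraicFunOn.mul_holds ht hAd).congr fun w _ => ?_,
    (IsSemialgebraicFunOn.mul_holds hbc ht).congr fun w _ => ?_, hbc.congr fun w _ => ?_⟩
  · simp only [Pi.mul_apply, soloInformedC3A]; ring
  · simp only [Pi.mul_apply]; ring
  · simp only [Pi.mul_apply, soloInformedC3B]
  · simp only [mul_one]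

end Summit.KontsevichZagierPeriods.KontsevichZagierPeriods.Theorems

end
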